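import Summits.CriticalPhenomena.PercolationContinuityZ3.Theorems.Transplant.SkelConcReachClauses
import Summits.CriticalPhenomena.PercolationContinuityZ3.Theorems.Transplant.SkelConcParamsRoot
import HarnessLib

/-!
# L7 (Z), part (C): the CORRIDOR obligation of the CONCRETE GENERIC choice function — `SkelConc.reachHoldsRH_concChoice₀`
# (= `ReachHoldsRHFn concChoice₀` unfolded at every admissible centred instance) — p3-g5's `Skel.reachOblRH_concSG_kits` (the (C) residue of
# the concentric scheme of record with the habitat kit clauses discharged, SkelConcReachClauses) instantiated at stmt-g7's `SkelConc.concChoice₀`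
# through the `AtQ` unpacking of `SkelConcParamsAtQ` / `SkelConcParamsRoot` — generic twin of `BoxProdZ2ConcReachHolds`

builds on p205010 (kernel theorem, internal audit signed; external expert review pending) — nothing in this file uses p205010.
Status sentence (coordinator 2026-08-20T04:30Z): "θ(p_c) = 0 on ℤ^d, all d ≥ 2 — kernel-verified (Lean 4/Mathlib, standard axioms); internal
adversarial audit SIGNED 2026-08-20 04:29Z; external expert review pending."
Lane `prim-bschramm-*`, seat `prim-bschramm-p2` (gen 5; (C) wrapper by the lead's ruling 22:22:36Z (1) / p5-g5 22:38:28Z, so that the refuter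
signs nothing it typed); helper file (`--supports stmt-CriticalPhenomena-4575`).

Constants fed (the (C) binder list of `reachOblRH_concSG_kits`, p3-g5 22:45Z; p5-g4's k-audit 21:50:32Z): `tp := Conc.tc`, `R' := Conc.R'c =
L + 8 M₀ + 13`, window `j₀ := 8 M₀ + 13`, `j₁ := Rlev := 8 M₀ + 12 + L`, `ℓ₀ := M₀ + 1`, `N := Conc.Nc`, `k := Conc.kc`, scales `Conc.Sc`, seed slab
`ℓs := M₀ + 1`, `Rc := Conc.Rseedc`, `r₀ := Conc.r₀c`, `rs := Conc.rsc`, accuracy `δ := κ.δ` with input margin `a := κ.δ²` (inputs at `δmin² ≤ κ.δ²`),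
`η := Conc.ηc ≤ κ.δ / 2`, excess radius `Rex := Conc.Rexc q` at planar diameter `50 r ≤ 60 r`, `gap := Conc.gapc` (`20 r ≤ 100 r ≤ gap`, `L' ≤ gap`,
`Rex (E g + 1) + L' ≤ E (g+1)` dropping the drift `100 r`), `44 r + 3 ≤ 44 r + 4 ≤ E₀`, `L' ≤ E₀`, rim room `r₀ + 3 ≤ L'` and
`ψ(6t) + ψ M₀ + 3 ≤ L'` from `Conc.hL_reach` (`12 t` of slack).
* **`SkelConc.reachHoldsRH_concChoice₀`** — `(concChoice₀ κ G Φ hc t ht h0 p hp0 hp1 hC).ReachHoldsRH` (the folded `ReachHoldsRHFn concChoice₀`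
  one-liner is left to (Z'), cf. the gate's statement dedup against the product's `BoxProdZ2.reachHoldsRFn_concChoice₀`).
[cite: KozmaNitzan2024, §4 Theorem 6 (pp. 25–31), Step IV (p. 30); Lemma 12 (pp. 23–25)]
-/

noncomputable section

open MeasureTheory
open scoped Classical

namespace Summit.CriticalPhenomena.PercolationContinuityZ3.Theorems

namespace Transplant

namespace SkelConc

open Literature.Probability.Percolation Literature.Probability.LatticeModels SimpleGraph KNCells KNLevels
open BoxProdZ2 (δmin δmin_le_δ)

/-- **The corridor obligation (C) of the concrete generic choice function, habitat run form, at every admissible centred instance.**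
[cite: KozmaNitzan2024, §4 Theorem 6, Step IV (p. 30); Lemma 12 (pp. 23–25)] -/
theorem reachHoldsRH_concChoice₀ (κ : Consts) {V : Type} [DecidableEq V] [Countable V] (G : SimpleGraph V) [G.LocallyFinite]
    (Φ : PlanarSkeletonConc G) (hc : G.Connected) (t : V) (ht : t ∈ Φ.types) (h0 : Φ.φ t = 0) (p : unitInterval) (hp0 : 0 < (p : ℝ))
    (hp1 : (p : ℝ) < 1) (hC : Φ.toPlanarSkeleton.CylSubcritical p) : (concChoice₀ κ G Φ hc t ht h0 p hp0 hp1 hC).ReachHoldsRH := by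
  intro msel M₀ q hat
  -- abbreviations
  have hδA : 0 < δA Φ κ.K₀ κ.δ₂ := δA_pos Φ κ.K₀ κ.δ₂
  have ha : δmin (κ.prod Φ.Δ) Conc.nR (δA Φ κ.K₀ κ.δ₂) ≤ κ.δ := δmin_le_δ (κ.prod Φ.Δ) Conc.nR (δA Φ κ.K₀ κ.δ₂)
  have hη : Conc.ηc κ Φ (δA Φ κ.K₀ κ.δ₂) ≤ κ.δ / 2 := by unfold Conc.ηc; linarith [ha]
  have hΛ : Skel.WFS (Conc.Cc κ Φ p hC (δA Φ κ.K₀ κ.δ₂) M₀) (Conc.Λc κ Φ p hC (δA Φ κ.K₀ κ.δ₂) M₀ q) :=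
    (wfHoldsFn_concChoice₀ κ G Φ hc t ht h0 p hp0 hp1 hC msel M₀ q hat).1
  -- planar numerics
  have hR'eq := Conc.R'c_eq (κ := κ) (Φ := Φ) (p := p) (hC := hC) (δA := δA Φ κ.K₀ κ.δ₂) (M := M₀)
  have hRl : 8 * M₀ + 12 + Conc.Lc κ Φ p hC (δA Φ κ.K₀ κ.δ₂) M₀ + 1 ≤ Conc.R'c κ Φ p hC (δA Φ κ.K₀ κ.δ₂) M₀ := by rw [hR'eq]; omega
  have hT₀ : SkelI.tanOff (M₀ + 1) M₀ = 3 * M₀ + 4 := by unfold SkelI.tanOff; omega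
  have hj₀ : SkelI.tanOff (M₀ + 1) M₀ ≤ 8 * M₀ + 12 + 1 := by rw [hT₀]; omega
  have htc := Conc.one_le_tc (κ := κ) (Φ := Φ) (p := p) (hC := hC) (δA := δA Φ κ.K₀ κ.δ₂) (M := M₀)
  -- the seed-kit constants
  obtain ⟨hk₁, hk₂, hk₃, hk₄, hk₅, hk₆⟩ := Conc.seedKit_ineqs (Φ := Φ) (p := p) (hC := hC) (M := M₀)
  have hR'₁ : Φ.cylRadMax (M₀ + 1) ((M₀ + 1) + 2 + 2 * SkelI.tanOff (M₀ + 1) M₀) ≤ Conc.Rseedc Φ p hC M₀ := by rw [hT₀]; exact hk₁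
  have hr₀₁ : (M₀ + 1) + 1 + SkelI.tanOff (M₀ + 1) M₀ + Conc.Rseedc Φ p hC M₀ ≤ Conc.r₀c Φ p hC M₀ := by rw [hT₀]; exact hk₃
  have hr₀₂ : 2 * (M₀ + 1) + 2 + SkelI.tanOff (M₀ + 1) M₀ + M₀ + Skel.fatRadius Φ hC M₀ ≤ Conc.r₀c Φ p hC M₀ := by rw [hT₀]; exact hk₄
  have hrs₁ : (M₀ + 1) + 2 + SkelI.tanOff (M₀ + 1) M₀ + Conc.Rseedc Φ p hC M₀ ≤ Conc.rsc Φ p hC M₀ := by rw [hT₀]; exact hk₅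
  have hrs₂ : 2 * (M₀ + 1) + 3 + SkelI.tanOff (M₀ + 1) M₀ + M₀ + Skel.fatRadius Φ hC M₀ ≤ Conc.rsc Φ p hC M₀ := by rw [hT₀]; exact hk₆
  -- rim rooms: `r₀ + 3 ≤ L'`, `ψ(6t) + ψ M₀ + 3 ≤ L'` (from `L' = L_A + ψ(6t) + ψ M₀ + 12 t + 2 M₀ + reachK`, `r₀ ≤ reachK`, `t ≥ 1`)
  have hreach : Skel.fatRadius Φ hC (6 * Conc.tc κ Φ p hC (δA Φ κ.K₀ κ.δ₂) M₀) + Skel.fatRadius Φ hC M₀ +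
      12 * Conc.tc κ Φ p hC (δA Φ κ.K₀ κ.δ₂) M₀ + 2 * M₀ ≤ Conc.L'c κ Φ p hC (δA Φ κ.K₀ κ.δ₂) M₀ q :=
    Conc.hL_reach (κ := κ) (Φ := Φ) (p := p) (hC := hC) (δA := δA Φ κ.K₀ κ.δ₂) (M := M₀) (q := q)
  have hψL : Skel.fatRadius Φ hC (6 * Conc.tc κ Φ p hC (δA Φ κ.K₀ κ.δ₂) M₀) + Skel.fatRadius Φ hC M₀ + 3 ≤
      Conc.L'c κ Φ p hC (δA Φ κ.K₀ κ.δ₂) M₀ q := by omega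
  have hr₀L : Conc.r₀c Φ p hC M₀ + 3 ≤ Conc.L'c κ Φ p hC (δA Φ κ.K₀ κ.δ₂) M₀ q := by
    have h1 := (Conc.r₀c_le (Φ := Φ) (p := p) (hC := hC) (M := M₀)).2
    have h2 := Conc.reachK_le_L' (κ := κ) (Φ := Φ) (p := p) (hC := hC) (δA := δA Φ κ.K₀ κ.δ₂) (M := M₀) (q := q)
    have h3 : Conc.L'c κ Φ p hC (δA Φ κ.K₀ κ.δ₂) M₀ q = Conc.LAc κ Φ p hC (δA Φ κ.K₀ κ.δ₂) M₀ q +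
        Skel.fatRadius Φ hC (6 * Conc.tc κ Φ p hC (δA Φ κ.K₀ κ.δ₂) M₀) + Skel.fatRadius Φ hC M₀ + 12 * Conc.tc κ Φ p hC (δA Φ κ.K₀ κ.δ₂) M₀ +
        2 * M₀ + Conc.reachK Φ p hC M₀ := rfl
    omega
  -- the kit counts in the seed-slab form
  have hkc : (1 - (q : ℝ) ^ (1 + Φ.Δ * ((Φ.Δ + 1) ^ Conc.Rseedc Φ p hC M₀ + (SkelI.tanOff (M₀ + 1) M₀ + 2)) +
      ((Φ.Δ + 1) ^ Conc.Rseedc Φ p hC M₀ + (SkelI.tanOff (M₀ + 1) M₀ + 2)) * (Φ.Δ + 1) ^ Skel.fatRadius Φ hC M₀)) ^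
        Conc.kc κ Φ p hC (δA Φ κ.K₀ κ.δ₂) M₀ ≤ κ.δ := by
    have h := Conc.hk_at hat hp0 hp1 ha
    rw [Conc.sBc_eq, Conc.cSc_eq, Conc.cUc_eq] at h
    rw [hT₀]
    exact h
  have hN : Conc.kc κ Φ p hC (δA Φ κ.K₀ κ.δ₂) M₀ * (Φ.Δ + 1) ^ (2 * Conc.rsc Φ p hC M₀) ≤ Conc.Nc κ Φ p hC (δA Φ κ.K₀ κ.δ₂) M₀ := by
    have h := Conc.hN_at (κ := κ) (Φ := Φ) (hC := hC) (M := M₀) hδA hp0 hp1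
    rwa [Conc.Bc_eq] at h
  -- (C)-specific schedule facts
  have hE₀ : 44 * (Conc.Cc κ Φ p hC (δA Φ κ.K₀ κ.δ₂) M₀).r + 3 ≤ Conc.E₀c κ Φ p hC (δA Φ κ.K₀ κ.δ₂) M₀ q := by
    have h := Conc.fortyfour_le_E₀ (κ := κ) (Φ := Φ) (p := p) (hC := hC) (δA := δA Φ κ.K₀ κ.δ₂) (M := M₀) (q := q); omega
  have hsch : ∀ g, Conc.Rexc κ Φ p hC (δA Φ κ.K₀ κ.δ₂) M₀ q
      (BoxProdZ2.Erad (Conc.gapc κ Φ p hC (δA Φ κ.K₀ κ.δ₂) M₀ q) (fun _ => 0) (Conc.E₀c κ Φ p hC (δA Φ κ.K₀ κ.δ₂) M₀ q) g + 1) +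
        Conc.L'c κ Φ p hC (δA Φ κ.K₀ κ.δ₂) M₀ q ≤
      BoxProdZ2.Erad (Conc.gapc κ Φ p hC (δA Φ κ.K₀ κ.δ₂) M₀ q) (fun _ => 0) (Conc.E₀c κ Φ p hC (δA Φ κ.K₀ κ.δ₂) M₀ q) (g + 1) := by
    intro g
    have h := Conc.hsch (κ := κ) (Φ := Φ) (p := p) (hC := hC) (δA := δA Φ κ.K₀ κ.δ₂) (M := M₀) (q := q) g
    omega
  -- assemble
  exact Skel.reachOblRH_concSG_kits Φ (Conc.Cc κ Φ p hC (δA Φ κ.K₀ κ.δ₂) M₀) t (Conc.gapc κ Φ p hC (δA Φ κ.K₀ κ.δ₂) M₀ q) (fun _ => 0)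
    (Conc.E₀c κ Φ p hC (δA Φ κ.K₀ κ.δ₂) M₀ q) (Conc.L'c κ Φ p hC (δA Φ κ.K₀ κ.δ₂) M₀ q) q κ.δ hC msel
    (tp := Conc.tc κ Φ p hC (δA Φ κ.K₀ κ.δ₂) M₀) (R' := Conc.R'c κ Φ p hC (δA Φ κ.K₀ κ.δ₂) M₀)
    (Rlev := 8 * M₀ + 12 + Conc.Lc κ Φ p hC (δA Φ κ.K₀ κ.δ₂) M₀) (N := Conc.Nc κ Φ p hC (δA Φ κ.K₀ κ.δ₂) M₀) (j₀ := 8 * M₀ + 12 + 1)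
    (j₁ := 8 * M₀ + 12 + Conc.Lc κ Φ p hC (δA Φ κ.K₀ κ.δ₂) M₀)
    Conc.hr Conc.hR100 hRl le_rfl hΛ h0 Conc.twenty_r_le_gap hE₀ Conc.hgapL Conc.L'_le_E₀ (Δ' := Φ.Δ) (δ := κ.δ)
    (η := Conc.ηc κ Φ (δA Φ κ.K₀ κ.δ₂)) (Conc.hcount_Icc_at hat hp0 hp1 ha (8 * M₀ + 12)) hη
    (Rex := fun ρ => Conc.Rexc κ Φ p hC (δA Φ κ.K₀ κ.δ₂) M₀ q ρ)
    (Conc.hRex_at_le hat le_rfl t (m := 50 * (Conc.Cc κ Φ p hC (δA Φ κ.K₀ κ.δ₂) M₀).r) (by omega)) hsch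
    (Ssc := Conc.Sc κ Φ p hC (δA Φ κ.K₀ κ.δ₂) M₀) (a := κ.δ ^ 2) κ.hδ0 le_rfl (Conc.inputs_at_le hat ha) Conc.mem_Sc (Conc.hmsel_at hat)
    (ℓ₀ := M₀ + 1) (Nat.lt_succ_self _) Conc.hℓ₀ (fun ℓ h₁ h₂ => Conc.mem_Sc_of ((Nat.le_succ M₀).trans h₁) h₂)
    (ℓs := M₀ + 1) (Rc := Conc.Rseedc Φ p hC M₀) (r₀ := Conc.r₀c Φ p hC M₀) (rs := Conc.rsc Φ p hC M₀) le_rfl hj₀ hR'₁ hk₂ hr₀₁ hr₀₂ hrs₁ hrs₂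
    hr₀L hψL (Conc.kc κ Φ p hC (δA Φ κ.K₀ κ.δ₂) M₀) hN hkc

end SkelConc

end Transplant

end Summit.CriticalPhenomena.PercolationContinuityZ3.Theorems

end
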